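import Literature.Probability.RandomPlanarGeometry.CritPercSLEDimensionZeroOne
import Mathlib.MeasureTheory.OuterMeasure.BorelCantelli
import Mathlib.Analysis.Complex.ReImTopology
import HarnessLib

/-!
# The a.s. upper bound `dim_H γ[0,∞) ≤ 2 - s` for the SLE trace from the one-point (upper) estimate

The named fact `Literature.Probability.RandomPlanarGeometry.ae_dimH_range_sleTrace` (Beffara's
theorem, `dim_H γ[0, ∞) = 1 + κ/8` a.s. for `0 < κ ≤ 8`) is reduced in `CritPercSLEDimension.lean`
to an a.s. upper bound `hU : dim_H γ[0, ∞) ≤ 1 + κ/8` (Rohde–Schramm (2005), Cor. 8.2 of Thm. 8.1),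
a lower bound with positive probability, the zero-one law and the phase `κ = 8`. This file
**proves the upper bound from the one-point estimate** — the first-moment half of Beffara's
Proposition 1 (Prop. 1 (1), "conditions 1 and 2 ⇒ a.s. `dim_H C ≤ d - s`", here in the form that
only uses the upper half of condition 1) and, equivalently, Rohde–Schramm's proof of Thm. 8.1 /
Cor. 8.2 from their one-point estimate (Lemma 6.3):

* `ae_dimH_closedSquare_inter_range_le` — if every point `z` of a square `Q ⊆ ℍ` satisfies
  `P(dist(z, γ[0, ∞)) ≤ ε) ≤ c₂ ε^s` for `0 < ε ≤ ε₀`, then a.s. `dim_H (Q ∩ γ[0, ∞)) ≤ 2 - s`: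
  the level-`k` dyadic grid of `Q` (`gridPt`, `(2^k+1)²` points, every point of `Q` within
  `εₖ = 2L/2^k` of the grid, `exists_gridPt_dist_lt`) has expected hit count
  `E Nₖ ≤ c₂ (2^k+1)² εₖ^s` (`lintegral_hitCount_le`, Tonelli over the a.e.-measurable hit events
  `hitEvent`, `aemeasurable_infEDist_range_sleTrace`); Markov and Borel–Cantelli
  (Mathlib `measure_limsup_atTop_eq_zero`) give a.s. `Nₖ < 2^{kα}` eventually for every rational
  `α > 2 - s` (`count_bound`: the probabilities are `≤ C 2^{-k(α+s-2)}`); the balls of radius `εₖ`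
  around the hit grid points cover `Q ∩ γ[0, ∞)` (`inter_range_subset_iUnion_hit`), so
  `𝓗^α(Q ∩ γ) ≤ liminf Nₖ (2εₖ)^α ≤ (4L)^α < ∞` (Mathlib `hausdorffMeasure_le_liminf_sum`,
  `cover_identity`) and `dim_H ≤ α`.
* `ae_dimH_range_sleTrace_le_of_onePoint_upper` — the range lies in the real axis (dimension
  `1 ≤ 2 - s` for `s ≤ 1`, `dimH_setOf_im_eq_zero`) and countably many such squares
  (`exists_mem_hpSquare`); `ae_dimH_range_sleTrace_le_of_onePoint_upper'` is the normalisation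
  `s = 1 - κ/8` of the fact (= `hU`).

So Rohde–Schramm's Cor. 8.2 enters the proof of the fact only through the one-point estimate
`P(dist(z, γ[0,∞)) ≤ ε) ≤ c₂ ε^{1-κ/8}` on compacts of `ℍ` (RS Lemma 6.3; Beffara Prop. 4, upper
half), which is NOT proved here.

## References

* S. Rohde, O. Schramm, *Basic properties of SLE*, Ann. of Math. 161 (2005): Lemma 6.3, Thm. 8.1
  and Cor. 8.2 (journal p. 920).
* V. Beffara, *The dimension of the SLE curves*, Ann. Probab. 36 (2008): Prop. 1 (1), Prop. 4.
-/

noncomputable section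

open Set Filter Topology MeasureTheory ProbabilityTheory Metric Complex
open UpperHalfPlane (upperHalfPlaneSet isOpen_upperHalfPlaneSet)
open scoped NNReal ENNReal

namespace Literature.Probability.RandomPlanarGeometry

/-! ### The distance to the trace is an a.e.-measurable function of the path -/

section Dist

variable {κ : ℝ≥0}

/-- For a continuous curve, the extended distance to its range is the infimum over rational
times. [folklore] -/
theorem infEDist_range_eq_iInf_rat {γ : ℝ≥0 → ℂ} (hγ : Continuous γ) (z : ℂ) :
    infEDist z (range γ) = ⨅ q : ℚ, edist z (γ (q : ℝ).toNNReal) := by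
  have hsurj : Function.Surjective Real.toNNReal := fun x ↦ ⟨x, Real.toNNReal_coe⟩
  have hdense : DenseRange (fun q : ℚ ↦ (q : ℝ).toNNReal) :=
    hsurj.denseRange.comp Rat.denseRange_cast continuous_real_toNNReal
  have hS : range (fun q : ℚ ↦ γ (q : ℝ).toNNReal) = γ '' range (fun q : ℚ ↦ (q : ℝ).toNNReal) := by
    rw [← range_comp]
    rfl
  have hcl : closure (range fun q : ℚ ↦ γ (q : ℝ).toNNReal) = closure (range γ) := by
    apply subset_antisymm
    · exact closure_mono (by rw [hS]; exact image_subset_range _ _)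
    · refine closure_minimal ?_ isClosed_closure
      rw [hS]
      exact hγ.range_subset_closure_image_dense hdense
  rw [← Metric.infEDist_closure, ← hcl, Metric.infEDist_closure, Metric.infEDist, iInf_range]

/-- If SLE_κ is generated by a curve, `ω ↦ infEDist z (γ_ω[0, ∞))` is a.e.-measurable (the trace
is an a.e.-measurable random path, `aemeasurable_sleTrace_pi`, and every trace is continuous).
[folklore] -/
theorem aemeasurable_infEDist_range_sleTrace (hκ : HasSLETrace κ) (z : ℂ) :
    AEMeasurable (fun ω ↦ infEDist z (range (sleTrace κ ω))) Process.preWienerMeasure := by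
  have hG : Measurable fun f : ℝ≥0 → ℂ ↦ ⨅ q : ℚ, edist z (f (q : ℝ).toNNReal) :=
    Measurable.iInf fun q ↦ measurable_const.edist (measurable_pi_apply _)
  have heq : (fun ω ↦ infEDist z (range (sleTrace κ ω))) =
      (fun f : ℝ≥0 → ℂ ↦ ⨅ q : ℚ, edist z (f (q : ℝ).toNNReal)) ∘ fun ω ↦ sleTrace κ ω := by
    funext ω
    exact infEDist_range_eq_iInf_rat (continuous_sleTrace κ ω) z
  rw [heq]
  exact hG.comp_aemeasurable (aemeasurable_sleTrace_pi hκ)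

/-- The **hit event** `{dist(z, γ[0, ∞)) ≤ ε}`, written with the extended distance. [folklore] -/
def hitEvent (κ : ℝ≥0) (z : ℂ) (ε : ℝ) : Set (ℝ≥0 → ℝ) :=
  {ω | infEDist z (range (sleTrace κ ω)) ≤ ENNReal.ofReal ε}

/-- The hit event is `{infDist z γ[0,∞) ≤ ε}` (`ε ≥ 0`). [folklore] -/
theorem hitEvent_eq (κ : ℝ≥0) (z : ℂ) {ε : ℝ} (hε : 0 ≤ ε) :
    hitEvent κ z ε = {ω | infDist z (range (sleTrace κ ω)) ≤ ε} := by
  ext ω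
  simp only [hitEvent, mem_setOf_eq, infDist]
  rw [ENNReal.le_ofReal_iff_toReal_le (Metric.infEDist_ne_top (range_nonempty _)) hε]

/-- The hit events are null-measurable. [folklore] -/
theorem nullMeasurableSet_hitEvent (hκ : HasSLETrace κ) (z : ℂ) (ε : ℝ) :
    NullMeasurableSet (hitEvent κ z ε) Process.preWienerMeasure :=
  (aemeasurable_infEDist_range_sleTrace hκ z).nullMeasurableSet_preimage measurableSet_Iic

end Dist

/-! ### Dyadic grids of a square -/

section Grid

/-- The closed square with lower-left corner `a` and side `L`. [folklore] -/
def closedSquare (a : ℂ) (L : ℝ) : Set ℂ :=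
  {z | a.re ≤ z.re ∧ z.re ≤ a.re + L ∧ a.im ≤ z.im ∧ z.im ≤ a.im + L}

/-- The closed square is `[re a, re a + L] ×ℂ [im a, im a + L]`. [folklore] -/
theorem closedSquare_eq_reProdIm (a : ℂ) (L : ℝ) :
    closedSquare a L = Icc a.re (a.re + L) ×ℂ Icc a.im (a.im + L) := by
  ext z
  simp only [closedSquare, mem_setOf_eq, Complex.mem_reProdIm, mem_Icc]
  tauto

/-- The closed square is compact. [folklore] -/
theorem isCompact_closedSquare (a : ℂ) (L : ℝ) : IsCompact (closedSquare a L) := by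
  rw [closedSquare_eq_reProdIm]
  exact Metric.isCompact_of_isClosed_isBounded (isClosed_Icc.reProdIm isClosed_Icc)
    (Metric.isBounded_Icc _ _ |>.reProdIm (Metric.isBounded_Icc _ _))

/-- A square with `im a > 0` lies in the open upper half-plane. [folklore] -/
theorem closedSquare_subset_upperHalfPlaneSet {a : ℂ} (ha : 0 < a.im) (L : ℝ) :
    closedSquare a L ⊆ upperHalfPlaneSet := fun z hz ↦ by
  change 0 < z.im
  exact ha.trans_le hz.2.2.1

/-- The index set of the level-`k` dyadic grid: `{0, …, 2^k}²`. [folklore] -/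
def gridIndex (k : ℕ) : Finset (ℕ × ℕ) :=
  Finset.range (2 ^ k + 1) ×ˢ Finset.range (2 ^ k + 1)

/-- The grid has `(2^k + 1)²` points. [folklore] -/
theorem card_gridIndex (k : ℕ) : (gridIndex k).card = (2 ^ k + 1) ^ 2 := by
  rw [gridIndex, Finset.card_product, Finset.card_range, sq]

/-- The level-`k` **dyadic grid points** of the square: `a + (i + j I) L / 2^k`. [folklore] -/
def gridPt (a : ℂ) (L : ℝ) (k : ℕ) (ij : ℕ × ℕ) : ℂ :=
  a + ((ij.1 : ℝ) * (L / 2 ^ k) : ℝ) + ((ij.2 : ℝ) * (L / 2 ^ k) : ℝ) * I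

/-- Grid points lie in the square. [folklore] -/
theorem gridPt_mem_closedSquare {a : ℂ} {L : ℝ} (hL : 0 < L) {k : ℕ} {ij : ℕ × ℕ}
    (hij : ij ∈ gridIndex k) : gridPt a L k ij ∈ closedSquare a L := by
  simp only [gridIndex, Finset.mem_product, Finset.mem_range] at hij
  have h2k : (0 : ℝ) < 2 ^ k := by positivity
  have hi : (ij.1 : ℝ) ≤ 2 ^ k := by exact_mod_cast Nat.lt_succ_iff.1 hij.1
  have hj : (ij.2 : ℝ) ≤ 2 ^ k := by exact_mod_cast Nat.lt_succ_iff.1 hij.2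
  have hiL : (ij.1 : ℝ) * (L / 2 ^ k) ≤ L := by
    calc (ij.1 : ℝ) * (L / 2 ^ k) ≤ 2 ^ k * (L / 2 ^ k) := by gcongr
      _ = L := mul_div_cancel₀ L h2k.ne'
  have hjL : (ij.2 : ℝ) * (L / 2 ^ k) ≤ L := by
    calc (ij.2 : ℝ) * (L / 2 ^ k) ≤ 2 ^ k * (L / 2 ^ k) := by gcongr
      _ = L := mul_div_cancel₀ L h2k.ne'
  have hi0 : 0 ≤ (ij.1 : ℝ) * (L / 2 ^ k) := by positivity
  have hj0 : 0 ≤ (ij.2 : ℝ) * (L / 2 ^ k) := by positivity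
  simp only [closedSquare, gridPt, mem_setOf_eq, add_re, add_im, ofReal_re, ofReal_im, mul_re,
    mul_im, I_re, I_im, mul_zero, mul_one, add_zero, sub_zero]
  refine ⟨by linarith, by linarith, by linarith, by linarith⟩

/-- **Covering by the grid**: every point of the square is within `2L/2^k` of a level-`k` grid
point (round both coordinates down to the grid). [folklore] -/
theorem exists_gridPt_dist_lt {a : ℂ} {L : ℝ} (hL : 0 < L) (k : ℕ) {w : ℂ}
    (hw : w ∈ closedSquare a L) :
    ∃ ij ∈ gridIndex k, dist w (gridPt a L k ij) < 2 * L / 2 ^ k := by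
  obtain ⟨h1, h2, h3, h4⟩ := hw
  set h : ℝ := L / 2 ^ k with hh
  have h2k : (0 : ℝ) < 2 ^ k := by positivity
  have hpos : 0 < h := by positivity
  set i : ℕ := ⌊(w.re - a.re) / h⌋₊ with hi
  set j : ℕ := ⌊(w.im - a.im) / h⌋₊ with hj
  have hxi : 0 ≤ (w.re - a.re) / h := div_nonneg (by linarith) hpos.le
  have hxj : 0 ≤ (w.im - a.im) / h := div_nonneg (by linarith) hpos.le
  have hik : i ≤ 2 ^ k := by
    rw [hi]
    refine Nat.floor_le_of_le ?_
    rw [div_le_iff₀ hpos, hh]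
    calc w.re - a.re ≤ L := by linarith
      _ = ((2 ^ k : ℕ) : ℝ) * (L / 2 ^ k) := by push_cast; rw [mul_div_cancel₀ L h2k.ne']
  have hjk : j ≤ 2 ^ k := by
    rw [hj]
    refine Nat.floor_le_of_le ?_
    rw [div_le_iff₀ hpos, hh]
    calc w.im - a.im ≤ L := by linarith
      _ = ((2 ^ k : ℕ) : ℝ) * (L / 2 ^ k) := by push_cast; rw [mul_div_cancel₀ L h2k.ne']
  refine ⟨(i, j), ?_, ?_⟩
  · simp only [gridIndex, Finset.mem_product, Finset.mem_range]
    exact ⟨Nat.lt_succ_of_le hik, Nat.lt_succ_of_le hjk⟩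
  -- the coordinate errors are `< h`
  have hre : |w.re - (a.re + i * h)| < h := by
    have hfl : (i : ℝ) ≤ (w.re - a.re) / h := Nat.floor_le hxi
    have hfl' : (w.re - a.re) / h < i + 1 := Nat.lt_floor_add_one _
    rw [le_div_iff₀ hpos] at hfl
    rw [div_lt_iff₀ hpos] at hfl'
    rw [abs_lt]
    constructor <;> nlinarith
  have him : |w.im - (a.im + j * h)| < h := by
    have hfl : (j : ℝ) ≤ (w.im - a.im) / h := Nat.floor_le hxj
    have hfl' : (w.im - a.im) / h < j + 1 := Nat.lt_floor_add_one _
    rw [le_div_iff₀ hpos] at hfl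
    rw [div_lt_iff₀ hpos] at hfl'
    rw [abs_lt]
    constructor <;> nlinarith
  have hdre : (w - gridPt a L k (i, j)).re = w.re - (a.re + i * h) := by
    simp only [gridPt, sub_re, add_re, ofReal_re, mul_re, ofReal_im, I_re, I_im, mul_zero, mul_one,
      sub_zero, hh]
    ring
  have hdim : (w - gridPt a L k (i, j)).im = w.im - (a.im + j * h) := by
    simp only [gridPt, sub_im, add_im, ofReal_re, mul_im, ofReal_im, I_re, I_im, mul_zero, mul_one,
      add_zero, hh]
  rw [dist_eq_norm]
  calc ‖w - gridPt a L k (i, j)‖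
      ≤ |(w - gridPt a L k (i, j)).re| + |(w - gridPt a L k (i, j)).im| :=
        Complex.norm_le_abs_re_add_abs_im _
    _ < h + h := by rw [hdre, hdim]; exact add_lt_add hre him
    _ = 2 * L / 2 ^ k := by rw [hh]; ring

end Grid


/-! ### Real arithmetic of the dyadic scales -/

section Arith

/-- `((2:ℝ)^k)^e = ((2:ℝ)^e)^k`. [folklore] -/
theorem two_pow_rpow_comm (k : ℕ) (e : ℝ) : ((2 : ℝ) ^ k) ^ e = ((2 : ℝ) ^ e) ^ k := by
  rw [← Real.rpow_natCast 2 k, ← Real.rpow_mul (by norm_num), mul_comm, Real.rpow_mul (by norm_num),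
    Real.rpow_natCast]

/-- **The first-moment count**: `(2^k + 1)² (2L/2^k)^s / (2^k)^α ≤ 4 (2L)^s (2^k)^{2-s-α}`
(`L ≥ 0`). [folklore] -/
theorem count_bound {L : ℝ} (hL : 0 ≤ L) (s α : ℝ) (k : ℕ) :
    ((2 : ℝ) ^ k + 1) ^ 2 * (2 * L / 2 ^ k) ^ s / ((2 : ℝ) ^ k) ^ α ≤
      4 * (2 * L) ^ s * ((2 : ℝ) ^ k) ^ (2 - s - α) := by
  set N : ℝ := (2 : ℝ) ^ k with hN
  have hN1 : 1 ≤ N := one_le_pow₀ (by norm_num)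
  have hN0 : 0 < N := by positivity
  have h1 : (N + 1) ^ 2 ≤ 4 * N ^ 2 := by nlinarith
  have h2 : (2 * L / N) ^ s = (2 * L) ^ s * N ^ (-s) := by
    rw [Real.div_rpow (by positivity) hN0.le, Real.rpow_neg hN0.le, div_eq_mul_inv]
  have h3 : N ^ (2 - s - α) = N ^ 2 * N ^ (-s) * (N ^ α)⁻¹ := by
    rw [show (2 : ℝ) - s - α = 2 + -s + -α by ring, Real.rpow_add hN0, Real.rpow_add hN0,
      Real.rpow_neg hN0.le α]
    norm_cast
  rw [h2, h3, div_eq_mul_inv]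
  have hα0 : 0 < (N ^ α)⁻¹ := inv_pos.2 (Real.rpow_pos_of_pos hN0 α)
  have hs0 : 0 ≤ (2 * L) ^ s * N ^ (-s) := by positivity
  calc (N + 1) ^ 2 * ((2 * L) ^ s * N ^ (-s)) * (N ^ α)⁻¹
      ≤ 4 * N ^ 2 * ((2 * L) ^ s * N ^ (-s)) * (N ^ α)⁻¹ := by gcongr
    _ = 4 * (2 * L) ^ s * (N ^ 2 * N ^ (-s) * (N ^ α)⁻¹) := by ring

/-- The covering identity `(2^α)^k · (2 · 2L/2^k)^α = (4L)^α` (`L ≥ 0`). [folklore] -/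
theorem cover_identity {L : ℝ} (hL : 0 ≤ L) (α : ℝ) (k : ℕ) :
    ((2 : ℝ) ^ α) ^ k * (2 * (2 * L / 2 ^ k)) ^ α = (4 * L) ^ α := by
  have hN0 : (0 : ℝ) < 2 ^ k := by positivity
  rw [← two_pow_rpow_comm, show (2 : ℝ) * (2 * L / 2 ^ k) = 4 * L / 2 ^ k by ring,
    Real.div_rpow (by positivity) hN0.le, mul_div_cancel₀ _ (Real.rpow_pos_of_pos hN0 α).ne']

end Arith

/-! ### The first-moment argument in one square -/

section Square

variable {κ : ℝ≥0}

/-- The **hit count** at level `k`: the number of level-`k` grid points of the square within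
distance `εₖ = 2L/2^k` of the trace, as an `ℝ≥0∞`-valued sum of indicators. [folklore] -/
def hitCount (κ : ℝ≥0) (a : ℂ) (L : ℝ) (k : ℕ) (ω : ℝ≥0 → ℝ) : ℝ≥0∞ :=
  ∑ ij ∈ gridIndex k, (hitEvent κ (gridPt a L k ij) (2 * L / 2 ^ k)).indicator 1 ω

open Classical in
/-- The grid points hit at level `k`. [folklore] -/
def hitFinset (κ : ℝ≥0) (a : ℂ) (L : ℝ) (k : ℕ) (ω : ℝ≥0 → ℝ) : Finset (ℕ × ℕ) :=
  (gridIndex k).filter fun ij ↦ ω ∈ hitEvent κ (gridPt a L k ij) (2 * L / 2 ^ k)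

/-- The hit count is the cardinality of the hit set. [folklore] -/
theorem hitCount_eq_card (κ : ℝ≥0) (a : ℂ) (L : ℝ) (k : ℕ) (ω : ℝ≥0 → ℝ) :
    hitCount κ a L k ω = (hitFinset κ a L k ω).card := by
  classical
  simp only [hitCount, hitFinset, indicator_apply, Pi.one_apply, Finset.sum_boole]

/-- The hit count is a.e.-measurable. [folklore] -/
theorem aemeasurable_hitCount (hκ : HasSLETrace κ) (a : ℂ) (L : ℝ) (k : ℕ) :
    AEMeasurable (hitCount κ a L k) Process.preWienerMeasure := by
  refine Finset.aemeasurable_fun_sum _ fun ij _ ↦ ?_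
  exact (aemeasurable_indicator_iff₀ (nullMeasurableSet_hitEvent hκ _ _)).2 aemeasurable_const

/-- The grid count as an extended real: `((2^k+1)² : ℕ) = ofReal ((2^k + 1)²)`. [folklore] -/
theorem natCast_card_grid (k : ℕ) :
    (((2 ^ k + 1) ^ 2 : ℕ) : ℝ≥0∞) = ENNReal.ofReal (((2 : ℝ) ^ k + 1) ^ 2) := by
  rw [← ENNReal.ofReal_natCast]
  push_cast
  ring_nf

/-- **Expected hit count**: `E Nₖ = ∑ P(hit) ≤ c₂ (2^k + 1)² εₖ^s` when every grid point is hit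
with probability `≤ c₂ εₖ^s`. [folklore] -/
theorem lintegral_hitCount_le (hκ : HasSLETrace κ) {a : ℂ} {L : ℝ} {k : ℕ} {c₂ : ℝ≥0∞} {s : ℝ}
    (h : ∀ ij ∈ gridIndex k, Process.preWienerMeasure (hitEvent κ (gridPt a L k ij) (2 * L / 2 ^ k)) ≤
      c₂ * ENNReal.ofReal ((2 * L / 2 ^ k) ^ s)) :
    ∫⁻ ω, hitCount κ a L k ω ∂Process.preWienerMeasure ≤
      c₂ * ENNReal.ofReal ((((2 : ℝ) ^ k + 1) ^ 2) * (2 * L / 2 ^ k) ^ s) := by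
  unfold hitCount
  rw [lintegral_finsetSum' (gridIndex k)
    (f := fun ij ω ↦ (hitEvent κ (gridPt a L k ij) (2 * L / 2 ^ k)).indicator 1 ω)
    fun ij _ ↦ (aemeasurable_indicator_iff₀ (nullMeasurableSet_hitEvent hκ _ _)).2 aemeasurable_const]
  calc ∑ ij ∈ gridIndex k, ∫⁻ ω, (hitEvent κ (gridPt a L k ij) (2 * L / 2 ^ k)).indicator 1 ω
        ∂Process.preWienerMeasure
      = ∑ ij ∈ gridIndex k, Process.preWienerMeasure (hitEvent κ (gridPt a L k ij) (2 * L / 2 ^ k)) :=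
        Finset.sum_congr rfl fun ij _ ↦ lintegral_indicator_one₀ (nullMeasurableSet_hitEvent hκ _ _)
    _ ≤ ∑ _ij ∈ gridIndex k, c₂ * ENNReal.ofReal ((2 * L / 2 ^ k) ^ s) := Finset.sum_le_sum h
    _ = ((2 ^ k + 1) ^ 2 : ℕ) * (c₂ * ENNReal.ofReal ((2 * L / 2 ^ k) ^ s)) := by
        rw [Finset.sum_const, card_gridIndex, nsmul_eq_mul]
    _ = c₂ * ENNReal.ofReal ((((2 : ℝ) ^ k + 1) ^ 2) * (2 * L / 2 ^ k) ^ s) := by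
        rw [natCast_card_grid, ENNReal.ofReal_mul (by positivity)]
        ring

/-- **The trace in the square is covered by the balls around the hit grid points** (every point
of the square is within `εₖ` of a grid point, which is then hit). [folklore] -/
theorem inter_range_subset_iUnion_hit {a : ℂ} {L : ℝ} (hL : 0 < L) (k : ℕ) (ω : ℝ≥0 → ℝ) :
    closedSquare a L ∩ range (sleTrace κ ω) ⊆
      ⋃ p : ↥(hitFinset κ a L k ω), ball (gridPt a L k p.1) (2 * L / 2 ^ k) := by
  classical
  rintro w ⟨hw, hwγ⟩
  obtain ⟨ij, hij, hdist⟩ := exists_gridPt_dist_lt hL k hw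
  have hhit : ω ∈ hitEvent κ (gridPt a L k ij) (2 * L / 2 ^ k) := by
    show infEDist (gridPt a L k ij) (range (sleTrace κ ω)) ≤ ENNReal.ofReal (2 * L / 2 ^ k)
    calc infEDist (gridPt a L k ij) (range (sleTrace κ ω)) ≤ edist (gridPt a L k ij) w :=
          Metric.infEDist_le_edist_of_mem hwγ
      _ ≤ ENNReal.ofReal (2 * L / 2 ^ k) := by
          rw [edist_dist, dist_comm]
          exact ENNReal.ofReal_le_ofReal hdist.le
  refine mem_iUnion.2 ⟨⟨ij, Finset.mem_filter.2 ⟨hij, hhit⟩⟩, ?_⟩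
  rw [mem_ball]
  exact hdist

/-- **The a.s. upper bound in one square.** If every point of the square is hit by the
`ε`-neighbourhood of the trace with probability `≤ c₂ ε^s` for `0 < ε ≤ ε₀`, then almost surely
`dim_H (Q ∩ γ[0, ∞)) ≤ 2 - s`: first moment of the dyadic hit counts, Markov, Borel–Cantelli
along the levels, and the covering by hit balls (Beffara (2008), Prop. 1 (1); Rohde–Schramm
(2005), proof of Thm. 8.1). [cite: Beffara2008, Prop. 1 (1)] -/
theorem ae_dimH_closedSquare_inter_range_le (hκ : HasSLETrace κ) {a : ℂ} {L : ℝ} (hL : 0 < L)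
    {s : ℝ} {c₂ : ℝ≥0∞} (hc₂ : c₂ ≠ ⊤) {ε₀ : ℝ} (hε₀ : 0 < ε₀)
    (hA : ∀ ε : ℝ, 0 < ε → ε ≤ ε₀ → ∀ z ∈ closedSquare a L,
      Process.preWienerMeasure {ω | infDist z (range (sleTrace κ ω)) ≤ ε} ≤
        c₂ * ENNReal.ofReal (ε ^ s)) :
    ∀ᵐ ω ∂Process.preWienerMeasure,
      dimH (closedSquare a L ∩ range (sleTrace κ ω)) ≤ ENNReal.ofReal (2 - s) := by
  haveI := isProbabilityMeasure_preWienerMeasure'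
  -- the scales `εₖ = 2L/2^k`, eventually `≤ ε₀`
  set ε : ℕ → ℝ := fun k ↦ 2 * L / 2 ^ k with hε
  have hεpos : ∀ k, 0 < ε k := fun k ↦ by rw [hε]; positivity
  have hεlim : Tendsto ε atTop (𝓝 0) := by
    have h := (tendsto_inv_atTop_zero.comp (tendsto_pow_atTop_atTop_of_one_lt one_lt_two)).const_mul
      (2 * L)
    rw [mul_zero] at h
    refine h.congr fun k ↦ ?_
    simp [hε, div_eq_mul_inv]
  obtain ⟨k₀, hk₀⟩ : ∃ k₀, ∀ k ≥ k₀, ε k ≤ ε₀ :=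
    eventually_atTop.1 (hεlim.eventually (Iic_mem_nhds hε₀))
  -- hit probabilities at the levels `k ≥ k₀`
  have hhit : ∀ k ≥ k₀, ∀ ij ∈ gridIndex k,
      Process.preWienerMeasure (hitEvent κ (gridPt a L k ij) (2 * L / 2 ^ k)) ≤
        c₂ * ENNReal.ofReal ((2 * L / 2 ^ k) ^ s) := by
    intro k hk ij hij
    rw [hitEvent_eq κ _ (hεpos k).le]
    exact hA (ε k) (hεpos k) (hk₀ k hk) _ (gridPt_mem_closedSquare hL hij)
  /- Step 1: for rational `α > 2 - s`, `α > 0`: a.s. `μH[α] (Q ∩ γ) ≤ (4L)^α` -/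
  have key : ∀ α : ℚ, 2 - s < α → (0 : ℝ) < α →
      ∀ᵐ ω ∂Process.preWienerMeasure, μH[(α : ℝ)] (closedSquare a L ∩ range (sleTrace κ ω)) ≤
        ENNReal.ofReal ((4 * L) ^ (α : ℝ)) := by
    intro α hαs hα0
    set τ : ℝ := (2 : ℝ) ^ (α : ℝ) with hτ
    have hτ1 : 1 < τ := Real.one_lt_rpow (by norm_num) hα0
    have hτ0 : 0 < τ := zero_lt_one.trans hτ1
    set ρ : ℝ := (2 : ℝ) ^ (2 - s - (α : ℝ)) with hρ
    have hρ1 : ρ < 1 := Real.rpow_lt_one_of_one_lt_of_neg (by norm_num) (by linarith)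
    -- the bad events `Aₖ = {Nₖ ≥ τ^k}` and their probabilities
    set A : ℕ → Set (ℝ≥0 → ℝ) := fun k ↦ {ω | ENNReal.ofReal (τ ^ k) ≤ hitCount κ a L k ω}
      with hA'
    have hPA : ∀ k ≥ k₀, Process.preWienerMeasure (A k) ≤
        c₂ * ENNReal.ofReal (4 * (2 * L) ^ s) * ENNReal.ofReal ρ ^ k := by
      intro k hk
      have hτk : 0 < τ ^ k := pow_pos hτ0 k
      calc Process.preWienerMeasure (A k)
          ≤ (∫⁻ ω, hitCount κ a L k ω ∂Process.preWienerMeasure) / ENNReal.ofReal (τ ^ k) :=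
            meas_ge_le_lintegral_div (aemeasurable_hitCount hκ a L k)
              (ENNReal.ofReal_pos.2 hτk).ne' ENNReal.ofReal_ne_top
        _ ≤ c₂ * ENNReal.ofReal ((((2 : ℝ) ^ k + 1) ^ 2) * (2 * L / 2 ^ k) ^ s) /
              ENNReal.ofReal (τ ^ k) := by
            gcongr
            exact lintegral_hitCount_le hκ (hhit k hk)
        _ = c₂ * ENNReal.ofReal ((((2 : ℝ) ^ k + 1) ^ 2) * (2 * L / 2 ^ k) ^ s / ((2 : ℝ) ^ k) ^ (α : ℝ)) := by
            rw [mul_div_assoc, ← ENNReal.ofReal_div_of_pos hτk, hτ, ← two_pow_rpow_comm]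
        _ ≤ c₂ * ENNReal.ofReal (4 * (2 * L) ^ s * ((2 : ℝ) ^ k) ^ (2 - s - (α : ℝ))) := by
            gcongr
            exact count_bound (by linarith) s α k
        _ = c₂ * ENNReal.ofReal (4 * (2 * L) ^ s) * ENNReal.ofReal ρ ^ k := by
            rw [two_pow_rpow_comm, ← hρ, ENNReal.ofReal_mul (by positivity), ENNReal.ofReal_pow
              (by positivity), mul_assoc]
    -- summability and Borel–Cantelli along `k + k₀`
    have hsum : ∑' k, Process.preWienerMeasure (A (k + k₀)) ≠ ⊤ := by
      have hle : ∀ k, Process.preWienerMeasure (A (k + k₀)) ≤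
          c₂ * ENNReal.ofReal (4 * (2 * L) ^ s) * ENNReal.ofReal ρ ^ (k + k₀) :=
        fun k ↦ hPA (k + k₀) (Nat.le_add_left k₀ k)
      refine ne_top_of_le_ne_top ?_ (ENNReal.tsum_le_tsum hle)
      rw [ENNReal.tsum_mul_left]
      refine ENNReal.mul_ne_top (ENNReal.mul_ne_top hc₂ ENNReal.ofReal_ne_top) ?_
      simp_rw [pow_add]
      rw [ENNReal.tsum_mul_right, ENNReal.tsum_geometric]
      refine ENNReal.mul_ne_top (ENNReal.inv_ne_top.2 ?_) (ENNReal.pow_ne_top ENNReal.ofReal_ne_top)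
      exact (tsub_pos_of_lt (ENNReal.ofReal_lt_one.2 hρ1)).ne'
    have hBC : Process.preWienerMeasure (limsup (fun k ↦ A (k + k₀)) atTop) = 0 :=
      measure_limsup_atTop_eq_zero hsum
    have hae : ∀ᵐ ω ∂Process.preWienerMeasure, ∀ᶠ k in atTop,
        hitCount κ a L (k + k₀) ω < ENNReal.ofReal (τ ^ (k + k₀)) := by
      have h0 : ∀ᵐ ω ∂Process.preWienerMeasure, ω ∉ limsup (fun k ↦ A (k + k₀)) atTop :=
        measure_eq_zero_iff_ae_notMem.1 hBC
      filter_upwards [h0] with ω hω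
      rw [mem_limsup_iff_frequently_mem, Filter.not_frequently] at hω
      filter_upwards [hω] with k hk
      simpa only [hA', mem_setOf_eq, not_le] using hk
    filter_upwards [hae] with ω hω
    -- the covering estimate
    have hdiam : ∀ k (p : ↥(hitFinset κ a L (k + k₀) ω)),
        ediam (ball (gridPt a L (k + k₀) p.1) (ε (k + k₀))) ≤ ENNReal.ofReal (2 * ε (k + k₀)) := by
      intro k p
      refine Metric.ediam_le_of_forall_dist_le fun x hx y hy ↦ ?_
      rw [mem_ball] at hx hy
      calc dist x y ≤ dist x (gridPt a L (k + k₀) p.1) + dist y (gridPt a L (k + k₀) p.1) :=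
            dist_triangle_right _ _ _
        _ ≤ 2 * ε (k + k₀) := by linarith
    have hcov := Measure.hausdorffMeasure_le_liminf_sum (ι := fun k ↦ ↥(hitFinset κ a L (k + k₀) ω)) (α : ℝ)
      (closedSquare a L ∩ range (sleTrace κ ω)) (l := atTop)
      (fun k ↦ ENNReal.ofReal (2 * ε (k + k₀))) ?_
      (fun k p ↦ ball (gridPt a L (k + k₀) p.1) (ε (k + k₀))) (Eventually.of_forall hdiam)
      (Eventually.of_forall fun k ↦ inter_range_subset_iUnion_hit hL (k + k₀) ω)
    swap
    · have h2 : Tendsto (fun k ↦ 2 * ε (k + k₀)) atTop (𝓝 0) := by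
        have h := (hεlim.comp (tendsto_add_atTop_nat k₀)).const_mul 2
        rw [mul_zero] at h
        exact h
      simpa using ENNReal.tendsto_ofReal h2
    refine hcov.trans ?_
    have hev : ∀ᶠ k in atTop, ∑ p : ↥(hitFinset κ a L (k + k₀) ω),
        ediam (ball (gridPt a L (k + k₀) p.1) (ε (k + k₀))) ^ (α : ℝ) ≤
          ENNReal.ofReal ((4 * L) ^ (α : ℝ)) := by
      filter_upwards [hω] with k hk
      have hdiam' : ∀ p : ↥(hitFinset κ a L (k + k₀) ω),
          ediam (ball (gridPt a L (k + k₀) p.1) (ε (k + k₀))) ^ (α : ℝ) ≤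
            ENNReal.ofReal ((2 * ε (k + k₀)) ^ (α : ℝ)) := fun p ↦
        calc ediam (ball (gridPt a L (k + k₀) p.1) (ε (k + k₀))) ^ (α : ℝ)
            ≤ ENNReal.ofReal (2 * ε (k + k₀)) ^ (α : ℝ) := ENNReal.rpow_le_rpow (hdiam k p) hα0.le
          _ = ENNReal.ofReal ((2 * ε (k + k₀)) ^ (α : ℝ)) :=
              ENNReal.ofReal_rpow_of_nonneg (by linarith [hεpos (k + k₀)]) hα0.le
      calc ∑ p : ↥(hitFinset κ a L (k + k₀) ω),
            ediam (ball (gridPt a L (k + k₀) p.1) (ε (k + k₀))) ^ (α : ℝ)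
          ≤ ∑ _p : ↥(hitFinset κ a L (k + k₀) ω), ENNReal.ofReal ((2 * ε (k + k₀)) ^ (α : ℝ)) :=
            Finset.sum_le_sum fun p _ ↦ hdiam' p
        _ = (hitFinset κ a L (k + k₀) ω).card * ENNReal.ofReal ((2 * ε (k + k₀)) ^ (α : ℝ)) := by
            rw [Finset.sum_const, Finset.card_univ, Fintype.card_coe, nsmul_eq_mul]
        _ ≤ ENNReal.ofReal (τ ^ (k + k₀)) * ENNReal.ofReal ((2 * ε (k + k₀)) ^ (α : ℝ)) := by
            gcongr
            rw [← hitCount_eq_card]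
            exact hk.le
        _ = ENNReal.ofReal ((4 * L) ^ (α : ℝ)) := by
            rw [← ENNReal.ofReal_mul (pow_pos hτ0 _).le, hτ, hε]
            exact congrArg _ (cover_identity hL.le α (k + k₀))
    calc liminf (fun k ↦ ∑ p : ↥(hitFinset κ a L (k + k₀) ω),
          ediam (ball (gridPt a L (k + k₀) p.1) (ε (k + k₀))) ^ (α : ℝ)) atTop
        ≤ liminf (fun _ : ℕ ↦ ENNReal.ofReal ((4 * L) ^ (α : ℝ))) atTop := liminf_le_liminf hev
      _ = ENNReal.ofReal ((4 * L) ^ (α : ℝ)) := liminf_const _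
  /- Step 2: all rational levels at once, and the conclusion -/
  have hall : ∀ᵐ ω ∂Process.preWienerMeasure, ∀ α : ℚ, 2 - s < α → (0 : ℝ) < α →
      dimH (closedSquare a L ∩ range (sleTrace κ ω)) ≤ ENNReal.ofReal α := by
    refine ae_all_iff.2 fun α ↦ ?_
    by_cases h : 2 - s < (α : ℝ) ∧ (0 : ℝ) < α
    · filter_upwards [key α h.1 h.2] with ω hω _ _
      have hne : μH[(α : ℝ)] (closedSquare a L ∩ range (sleTrace κ ω)) ≠ ⊤ :=
        ne_top_of_le_ne_top ENNReal.ofReal_ne_top hω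
      have hd := dimH_le_of_hausdorffMeasure_ne_top (d := (α : ℝ).toNNReal)
        (by rwa [Real.coe_toNNReal _ h.2.le])
      exact hd
    · exact Eventually.of_forall fun ω h1 h2 ↦ absurd ⟨h1, h2⟩ h
  filter_upwards [hall] with ω hω
  by_contra hlt
  push Not at hlt
  obtain ⟨q, -, hq1, hq2⟩ := ENNReal.lt_iff_exists_rat_btwn.1 hlt
  have hqpos : (0 : ℝ) < q := by
    by_contra hle
    push Not at hle
    have h0 : ((q : ℝ).toNNReal : ℝ≥0∞) = 0 := by simp [Real.toNNReal_of_nonpos hle]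
    rw [h0] at hq1
    exact ENNReal.not_lt_zero hq1
  have hqs : 2 - s < (q : ℝ) := (ENNReal.ofReal_lt_ofReal_iff hqpos).1 hq1
  exact absurd (hq2.trans_le (hω q hqs hqpos)) (lt_irrefl _)

end Square


/-! ### Assembly over the half-plane -/

section Global

variable {κ : ℝ≥0}

/-- The real axis of `ℂ` has Hausdorff dimension `1` (it is the isometric image of `ℝ`).
[folklore] -/
theorem dimH_setOf_im_eq_zero : dimH {z : ℂ | z.im = 0} = 1 := by
  have h : {z : ℂ | z.im = 0} = ((↑) : ℝ → ℂ) '' univ := by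
    ext z
    simp only [mem_setOf_eq, image_univ, mem_range]
    constructor
    · intro hz
      exact ⟨z.re, Complex.ext (by simp) (by simp [hz])⟩
    · rintro ⟨x, rfl⟩
      simp
  rw [h, Complex.isometry_ofReal.dimH_image, Real.dimH_univ_eq_finrank, Module.finrank_self,
    Nat.cast_one]

/-- The countable family of squares `Qₙ = [-(n+1), n+1] × [1/(n+1), 1/(n+1) + 2(n+1)]` covering the
open upper half-plane. [folklore] -/
def hpSquareCorner (n : ℕ) : ℂ :=
  ((-((n : ℝ) + 1) : ℝ) : ℂ) + ((1 / ((n : ℝ) + 1) : ℝ) : ℂ) * I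

/-- The corner has positive imaginary part. [folklore] -/
theorem hpSquareCorner_im (n : ℕ) : (hpSquareCorner n).im = 1 / ((n : ℝ) + 1) := by
  simp only [hpSquareCorner, add_im, ofReal_im, mul_im, ofReal_re, I_re, I_im, mul_zero, mul_one,
    zero_add, add_zero]

/-- The corner's real part. [folklore] -/
theorem hpSquareCorner_re (n : ℕ) : (hpSquareCorner n).re = -((n : ℝ) + 1) := by
  simp only [hpSquareCorner, add_re, ofReal_re, mul_re, ofReal_im, I_re, I_im, mul_zero, mul_one,
    sub_zero, add_zero]

/-- Every point of the open upper half-plane lies in some square `Qₙ`. [folklore] -/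
theorem exists_mem_hpSquare {z : ℂ} (hz : 0 < z.im) :
    ∃ n : ℕ, z ∈ closedSquare (hpSquareCorner n) (2 * ((n : ℝ) + 1)) := by
  obtain ⟨n, hn⟩ := exists_nat_ge (max |z.re| (max z.im (1 / z.im)))
  refine ⟨n, ?_⟩
  have h1 : |z.re| ≤ n := (le_max_left _ _).trans hn
  have h2 : z.im ≤ n := ((le_max_left _ _).trans (le_max_right _ _)).trans hn
  have h3 : 1 / z.im ≤ n := ((le_max_right _ _).trans (le_max_right _ _)).trans hn
  have hn0 : (0 : ℝ) < (n : ℝ) + 1 := by positivity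
  rw [abs_le] at h1
  simp only [closedSquare, mem_setOf_eq, hpSquareCorner_re, hpSquareCorner_im]
  refine ⟨by linarith, by linarith, ?_, ?_⟩
  · rw [div_le_iff₀ hn0]
    have : 1 ≤ z.im * n := by
      rw [div_le_iff₀ hz] at h3
      linarith
    nlinarith
  · have : 0 ≤ 1 / ((n : ℝ) + 1) := by positivity
    linarith

/-- **The a.s. upper bound `dim_H γ[0, ∞) ≤ 2 - s` from the one-point (upper) estimate.** If SLE_κ is
generated by a curve and, for every compact `K ⊆ ℍ`, `P(dist(z, γ[0, ∞)) ≤ ε) ≤ c₂ ε^s` for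
`z ∈ K`, `0 < ε ≤ ε₀` (constants depending on `K`; Beffara (2008), Prop. 4, upper half;
Rohde–Schramm (2005), Lemma 6.3 / proof of Thm. 8.1), with `s ≤ 1`, then almost surely
`dim_H γ[0, ∞) ≤ 2 - s`: the range lies in the real axis (dimension `1 ≤ 2 - s`) and countably many
squares of `ℍ`, in each of which `ae_dimH_closedSquare_inter_range_le` applies. For
`s = 1 - κ/8` this is Rohde–Schramm's Cor. 8.2, `dim_H γ[0, ∞) ≤ 1 + κ/8` a.s.
[cite: RohdeSchramm2005, Thm 8.1 and Cor. 8.2] -/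
theorem ae_dimH_range_sleTrace_le_of_onePoint_upper (hκ : HasSLETrace κ) {s : ℝ} (hs1 : s ≤ 1)
    (hA : ∀ K : Set ℂ, IsCompact K → K ⊆ upperHalfPlaneSet →
      ∃ c₂ : ℝ≥0∞, c₂ ≠ ⊤ ∧ ∃ ε₀ : ℝ, 0 < ε₀ ∧ ∀ ε : ℝ, 0 < ε → ε ≤ ε₀ → ∀ z ∈ K,
        Process.preWienerMeasure {ω | infDist z (range (sleTrace κ ω)) ≤ ε} ≤
          c₂ * ENNReal.ofReal (ε ^ s)) :
    ∀ᵐ ω ∂Process.preWienerMeasure, dimH (range (sleTrace κ ω)) ≤ ENNReal.ofReal (2 - s) := by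
  -- the squares
  have hsq : ∀ n : ℕ, ∀ᵐ ω ∂Process.preWienerMeasure,
      dimH (closedSquare (hpSquareCorner n) (2 * ((n : ℝ) + 1)) ∩ range (sleTrace κ ω)) ≤
        ENNReal.ofReal (2 - s) := by
    intro n
    have hL : 0 < 2 * ((n : ℝ) + 1) := by positivity
    have him : 0 < (hpSquareCorner n).im := by rw [hpSquareCorner_im]; positivity
    obtain ⟨c₂, hc₂, ε₀, hε₀, h⟩ := hA _ (isCompact_closedSquare _ _)
      (closedSquare_subset_upperHalfPlaneSet him _)
    exact ae_dimH_closedSquare_inter_range_le hκ hL hc₂ hε₀ h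
  rw [← ae_all_iff] at hsq
  filter_upwards [hsq] with ω hω
  -- decomposition of the range
  have hsub : range (sleTrace κ ω) ⊆ {z : ℂ | z.im = 0} ∪
      ⋃ n : ℕ, closedSquare (hpSquareCorner n) (2 * ((n : ℝ) + 1)) ∩ range (sleTrace κ ω) := by
    rintro _ ⟨t, rfl⟩
    have him : 0 ≤ (sleTrace κ ω t).im := Loewner.trace_im_nonneg _ t
    rcases him.eq_or_lt with h0 | hpos
    · exact Or.inl h0.symm
    · obtain ⟨n, hn⟩ := exists_mem_hpSquare hpos
      exact Or.inr (mem_iUnion.2 ⟨n, hn, t, rfl⟩)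
  have h1s : (1 : ℝ≥0∞) ≤ ENNReal.ofReal (2 - s) := by
    rw [← ENNReal.ofReal_one]
    exact ENNReal.ofReal_le_ofReal (by linarith)
  calc dimH (range (sleTrace κ ω))
      ≤ dimH ({z : ℂ | z.im = 0} ∪
          ⋃ n : ℕ, closedSquare (hpSquareCorner n) (2 * ((n : ℝ) + 1)) ∩ range (sleTrace κ ω)) :=
        dimH_mono hsub
    _ ≤ ENNReal.ofReal (2 - s) := by
        rw [dimH_union, dimH_setOf_im_eq_zero, dimH_iUnion]
        exact max_le h1s (iSup_le hω)

/-- **Rohde–Schramm's Cor. 8.2 from the one-point estimate, in the normalisation of the fact**: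
with `s = 1 - κ/8` (`κ < 8`), almost surely `dim_H γ[0, ∞) ≤ 1 + κ/8` — the hypothesis `hU` of
`ae_dimH_range_sleTrace_of_ae_le_of_pos_of_zero_one'` (`CritPercSLEDimension.lean`).
[cite: RohdeSchramm2005, Cor. 8.2] -/
theorem ae_dimH_range_sleTrace_le_of_onePoint_upper' (hκ : HasSLETrace κ)
    (hA : ∀ K : Set ℂ, IsCompact K → K ⊆ upperHalfPlaneSet →
      ∃ c₂ : ℝ≥0∞, c₂ ≠ ⊤ ∧ ∃ ε₀ : ℝ, 0 < ε₀ ∧ ∀ ε : ℝ, 0 < ε → ε ≤ ε₀ → ∀ z ∈ K,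
        Process.preWienerMeasure {ω | infDist z (range (sleTrace κ ω)) ≤ ε} ≤
          c₂ * ENNReal.ofReal (ε ^ (1 - (κ : ℝ) / 8))) :
    ∀ᵐ ω ∂Process.preWienerMeasure, dimH (range (sleTrace κ ω)) ≤ 1 + (κ : ℝ≥0∞) / 8 := by
  have hκ0 : (0 : ℝ) ≤ κ := κ.2
  have h := ae_dimH_range_sleTrace_le_of_onePoint_upper hκ (s := 1 - (κ : ℝ) / 8) (by linarith) hA
  have hconv : ENNReal.ofReal (2 - (1 - (κ : ℝ) / 8)) = 1 + (κ : ℝ≥0∞) / 8 := by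
    rw [show (2 : ℝ) - (1 - (κ : ℝ) / 8) = 1 + (κ : ℝ) / 8 by ring,
      ENNReal.ofReal_add zero_le_one (by positivity), ENNReal.ofReal_one,
      ENNReal.ofReal_div_of_pos (by norm_num), ENNReal.ofReal_coe_nnreal, ENNReal.ofReal_ofNat]
  rwa [hconv] at h

end Global

end Literature.Probability.RandomPlanarGeometry

end
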